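import Literature.NumberTheory.NumberFields.ConductorLocalCriterion
import Literature.NumberTheory.NumberFields.RayClassFieldSplitPrimePowerDegree
import Literature.NumberTheory.EllipticCurves.ZpExtensionLayersLocalSymbolProofs
import Summits.BirchSwinnertonDyer.BirchSwinnertonDyer.Theorems.SignedLowerHalvesSmallImageLowerHalfBothSignsRttD2FrameFinite
import Summits.BirchSwinnertonDyer.BirchSwinnertonDyer.Theorems.SignedLowerHalvesSmallImageLowerHalfBothSignsRttD2FrameReciprocity
import HarnessLib

/-!
# Route `SignedLowerHalves`, crux L `SmallImageLowerHalfBothSigns` (item stmt-BirchSwinnertonDyer-23599), line `rtt_w3` v15.1 —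
# THE CONDUCTOR of the torsion character: `χ₀ = 1` on `Gal(K̄/K(𝔣))` for an explicit `𝔣 ≠ 0`, and ★★★★★ THE COMPLETE FRAME CHARACTER
# for stub A (`hker`, `hθfin`, `‖χ₀ − θ'‖ < 1`, `hθ𝔣`, `hN`-compatibility) — UNCONDITIONALLY from the stub's hypotheses

Resident INPUTS prover `bsd-inputs-honda-p1` g24 → LEAD `cruxlead-stmt-BirchSwinnertonDyer-23599` g11; helper `--supports stmt-BirchSwinnertonDyer-23599`; THEOREMS ONLY,
no `sorry`; closes nothing; BSD / crux L / stub A are NOT proved by this file.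

WHAT. `…RttD2FrameFinite.exists_torsionCharacter` gives `χ₀, η` with `χ₀η = θ'`, `χ₀^M = 1`, hker, and the conductor clause «`χ₀(g) = 1` once `θ'(g)` and
`η(g)` are within `r` of `1`», plus «`η` is within `ε` of `1` once `‖κᵢ(g)‖ < δ`». This file supplies the two ray-class inputs and assembles:
* §1 `exists_ideal_forall_norm_kappa_lt` — for `ℤ_p`-extensions `κ₁, κ₂` of a totally complex `K` and `δ > 0` there is `𝔣₀ ≠ 0` with `‖κᵢ(σ)‖ < δ` on
  `Gal(K̄/K(𝔣₀))`: the layers `K_n^{(i)}` are finite abelian (`isAbelianGalois_layer`), hence inside the ray class field of their conductor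
  (`le_rayClassField_conductor`, Neukirch VI (6.4)–(6.6)), and `Gal(K̄/K_n^{(i)}) = κᵢ⁻¹(pⁿℤ_p)` (`mem_layerSubgroup_iff_forall_smul`);
* §2 `exists_ideal_forall_norm_dual_sub_one_lt` — for the stub's pinned `θ` and its dual `θ'`, and `r > 0`: `‖θ'(σ) − 1‖ < r` on `Gal(K̄/K(𝔪p^{n+1}))`,
  `n ≫ 0` (`…RttD2FrameReciprocity.norm_dual_sub_one_le_of_mem_fixingSubgroup`, p795006);
* §3 ★★★★★ `exists_frameCharacter` — for the stub's data (`[K:ℚ] = 2`, `K` totally complex, `𝔪 ≠ 0`, `ψ` a Grössencharakter mod `𝔪`, `θ` pinned to `ψ`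
  away from `p𝔪`, `θ'·θ₀₀ = 1`, a topological generator pair `(κ₁, κ₂, γ₁, γ₂)`): **there are `χ₀ : Γ_K →ₜ* 𝒪ˣ`, `M > 0` and `𝔣 ≠ 0` with `χ₀^M = 1`,
  `θ' = χ₀` on `pairKer κ₁ κ₂` (hker) and wherever `κ₁ = κ₂ = 1`, `‖χ₀ − θ'‖ < 1`, and `χ₀ = 1` on `absGaloisFixingSubgroup (rayClassField K 𝔣)` (hθ𝔣 of
  `cor53_thm52ShapeO`)** — the frame character of design (b), replacing bk1's Teichmüller `χ₀` and its undischargeable hTors.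

References: [NeukirchANT1999] Ch. VI §6 (6.2)–(6.6); [Washington1997] §13.1; [deShalit1987] II.1.4–1.7; [Rubin1991] §4 p. 36; [JohnsonLeungKings2011] Cor. 5.3.
-/

set_option autoImplicit false
-- D-0017: single-problem summit, the namespace repeats the problem name by design.
set_option linter.dupNamespace false
noncomputable section

open scoped NumberField Topology nonZeroDivisors Polynomial
open Filter Field Polynomial NumberField IsDedekindDomain Literature.NumberTheory.EllipticCurves Literature.NumberTheory.NumberFields
  Literature.NumberTheory.GaloisRepresentations

namespace Summit.BirchSwinnertonDyer.BirchSwinnertonDyer.Theorems.SmallImageRttD2FrameConductor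

variable {p : ℕ} [Fact p.Prime] {K : Type} [Field K] [NumberField K]

/-! ## §1 The layers of a `ℤ_p`-extension lie in ray class fields: `κ` is small on `Gal(K̄/K(𝔣₀))` -/

/-- Fixing subgroups of ray class fields are monotone in the modulus: for `0 ≠ 𝔣 ≤ 𝔣'` (`𝔣' ∣ 𝔣`), `C_{𝔣'} ≤ C_𝔣`, so
`Gal(K̄/K(𝔣)) ≤ Gal(K̄/K(𝔣'))`. [cite: NeukirchANT1999, Ch. VI §6 (6.2)] -/
theorem absGaloisFixingSubgroup_rayClassField_mono {𝔣 𝔣' : Ideal (𝓞 K)} (h𝔣 : 𝔣 ≠ ⊥) (h : 𝔣 ≤ 𝔣') :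
    absGaloisFixingSubgroup (rayClassField K 𝔣) ≤ absGaloisFixingSubgroup (rayClassField K 𝔣') := fun σ hσ => by
  rw [mem_absGaloisFixingSubgroup_iff] at hσ ⊢
  exact fun x hx => hσ x (rayClassField_le_of_le h𝔣 h hx)

/-- **One layer**: for a `ℤ_p`-extension `κ` of a totally complex `K` and `n`, every `σ ∈ Gal(K̄/K(𝔣ₙ))`, `𝔣ₙ` the conductor of the layer `K_n`, satisfies
`pⁿ ∣ κ(σ)` (`K_n ⊆ K(𝔣ₙ)` and `Gal(K̄/K_n) = κ⁻¹(pⁿℤ_p)`). [cite: NeukirchANT1999, Ch. VI §6 Def. (6.4), Cor. (6.6)] [cite: Washington1997, §13.1] -/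
theorem exists_ideal_forall_pow_dvd [IsTotallyComplex K] (κ : ZpExtension K p) (n : ℕ) :
    ∃ 𝔣 : Ideal (𝓞 K), 𝔣 ≠ ⊥ ∧ ∀ σ ∈ absGaloisFixingSubgroup (rayClassField K 𝔣), (p : ℤ_[p]) ^ n ∣ (κ σ).toAdd := by
  haveI : FiniteDimensional K (κ.layer n) := κ.finiteDimensional_layer_holds n
  haveI : IsAbelianGalois K (κ.layer n) := κ.isAbelianGalois_layer n
  haveI : NumberField (κ.layer n) := NumberField.of_module_finite K _
  refine ⟨conductor (κ.layer n), conductor_ne_bot _, fun σ hσ => ?_⟩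
  rw [← ZpExtension.mem_layerSubgroup, κ.mem_layerSubgroup_iff_forall_smul n σ]
  rw [mem_absGaloisFixingSubgroup_iff] at hσ
  exact fun x hx => hσ x (le_rayClassField_conductor (κ.layer n) hx)

/-- ★ **Two `ℤ_p`-extensions are uniformly small on a ray class group**: for `δ > 0` there is `𝔣₀ ≠ 0` with `‖κ₁(σ)‖ < δ` and `‖κ₂(σ)‖ < δ` for all
`σ ∈ Gal(K̄/K(𝔣₀))`. [cite: NeukirchANT1999, Ch. VI §6 Def. (6.4), Cor. (6.6)] [cite: Washington1997, §13.1] -/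
theorem exists_ideal_forall_norm_kappa_lt [IsTotallyComplex K] (κ₁ κ₂ : ZpExtension K p) {δ : ℝ} (hδ : 0 < δ) :
    ∃ 𝔣₀ : Ideal (𝓞 K), 𝔣₀ ≠ ⊥ ∧ ∀ σ ∈ absGaloisFixingSubgroup (rayClassField K 𝔣₀),
      ‖(κ₁ σ).toAdd‖ < δ ∧ ‖(κ₂ σ).toAdd‖ < δ := by
  -- `p^{-n} < δ`
  have hp1 : ‖(p : ℤ_[p])‖ < 1 := PadicInt.norm_lt_one_iff_dvd _ |>.mpr (dvd_refl _)
  obtain ⟨n, hn⟩ := exists_pow_lt_of_lt_one hδ hp1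
  obtain ⟨𝔣₁, h𝔣₁, h₁⟩ := exists_ideal_forall_pow_dvd κ₁ n
  obtain ⟨𝔣₂, h𝔣₂, h₂⟩ := exists_ideal_forall_pow_dvd κ₂ n
  refine ⟨𝔣₁ * 𝔣₂, mul_ne_zero h𝔣₁ h𝔣₂, fun σ hσ => ?_⟩
  have hσ₁ : σ ∈ absGaloisFixingSubgroup (rayClassField K 𝔣₁) :=
    absGaloisFixingSubgroup_rayClassField_mono (mul_ne_zero h𝔣₁ h𝔣₂) Ideal.mul_le_right hσ
  have hσ₂ : σ ∈ absGaloisFixingSubgroup (rayClassField K 𝔣₂) :=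
    absGaloisFixingSubgroup_rayClassField_mono (mul_ne_zero h𝔣₁ h𝔣₂) Ideal.mul_le_left hσ
  have bound : ∀ z : ℤ_[p], (p : ℤ_[p]) ^ n ∣ z → ‖z‖ < δ := fun z hz => by
    obtain ⟨w, rfl⟩ := hz
    calc ‖(p : ℤ_[p]) ^ n * w‖ = ‖(p : ℤ_[p])‖ ^ n * ‖w‖ := by rw [norm_mul, norm_pow]
      _ ≤ ‖(p : ℤ_[p])‖ ^ n * 1 := mul_le_mul_of_nonneg_left (PadicInt.norm_le_one w) (pow_nonneg (norm_nonneg _) _)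
      _ < δ := by rw [mul_one]; exact hn
  exact ⟨bound _ (h₁ σ hσ₁), bound _ (h₂ σ hσ₂)⟩

/-! ## §2 The stub's dual character is uniformly close to `1` on a ray class group -/

/-- ★ For the stub's pinned `θ` and dual `θ'` (`θ'·θ₀₀ = 1`) and every `r > 0` there is `𝔐 ≠ 0` (namely `𝔪·p^{n+1}`, `‖p‖^{n+1} < r`) with
`‖θ'(σ) − 1‖ < r` on `Gal(K̄/K(𝔐))` (p795006 at all levels). [cite: deShalit1987, II.1.4–1.7 (p. 35–41)] [cite: SerreAbelianLadic1968, Ch. II §2.7] -/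
theorem exists_ideal_forall_norm_dual_sub_one_lt [IsTotallyComplex K] {𝔪 : Ideal (𝓞 K)} (h𝔪 : 𝔪 ≠ ⊥)
    {a b : InfinitePlace K → ℤ} {ψ : HeightOneSpectrum (𝓞 K) → ℂ} (hψ : IsGrossencharakter 𝔪 a b ψ)
    (e : PadicAlgCl p ≃+* ℂ) (S : Set (PadicAlgCl p)) (θ : FramedGaloisRep K (padicCoeffIntegers S) 1)
    (hθ : ∀ w : HeightOneSpectrum (𝓞 K), ((p : ℕ) : 𝓞 K) ∉ w.asIdeal → ¬ 𝔪 ≤ w.asIdeal →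
      θ.IsUnramifiedAt w ∧ ∃ P : Polynomial (padicCoeffIntegers S),
        P.map (padicCoeffIntegers S).subtype = X - C (e.symm (ψ w)) ∧ θ.HasFrobCharpolyAt w P)
    (θ' : absoluteGaloisGroup K →ₜ* (padicCoeffIntegers S)ˣ)
    (hθ' : ∀ g : absoluteGaloisGroup K, ((θ' g : (padicCoeffIntegers S)ˣ) : padicCoeffIntegers S) *
      ((θ g : GL (Fin 1) (padicCoeffIntegers S)) : Matrix (Fin 1) (Fin 1) (padicCoeffIntegers S)) 0 0 = 1)
    {r : ℝ} (hr : 0 < r) :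
    ∃ 𝔐 : Ideal (𝓞 K), 𝔐 ≠ ⊥ ∧ 𝔐 ≤ 𝔪 ∧ ∀ σ ∈ absGaloisFixingSubgroup (rayClassField K 𝔐),
      ‖(((θ' σ : (padicCoeffIntegers S)ˣ) : padicCoeffIntegers S) : PadicAlgCl p) - 1‖ < r := by
  have hp1 : ‖(p : padicCoeffIntegers S)‖ < 1 := by
    rw [SmallImageRttD2FrameReciprocity.norm_natCast_coeffIntegers]; exact Literature.NumberTheory.Automorphic.PadicAlgCl.norm_natCast_p_lt_one p
  obtain ⟨n, hn⟩ := exists_pow_lt_of_lt_one hr hp1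
  obtain ⟨h1, h2, h3⟩ := SmallImageRttD2FrameReciprocity.mul_span_natCast_pow_props (K := K) (p := p) h𝔪 n
  refine ⟨𝔪 * Ideal.span {((p : ℕ) : 𝓞 K)} ^ (n + 1), h1, h2, fun σ hσ => ?_⟩
  have h := SmallImageRttD2FrameReciprocity.norm_dual_sub_one_le_of_mem_fixingSubgroup h𝔪 hψ e S θ hθ θ' hθ' h1 h2 h3 hσ
  rw [SmallImageRttD2FrameReciprocity.norm_coeffIntegers_eq, AddSubgroupClass.coe_sub, OneMemClass.coe_one] at h
  refine h.trans_lt ((pow_le_pow_of_le_one (norm_nonneg _) hp1.le (Nat.le_succ n)).trans_lt hn)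

/-! ## §3 ★★★★★ The frame character of stub A -/

/-- ★★★★★ **THE FRAME CHARACTER (design (b) of the hTors repair, all inputs discharged).** Data of `stub_charRoadFrame_ns`: `K` totally complex with
`[K:ℚ] = 2`, `𝔪 ≠ 0`, a Grössencharakter `ψ mod 𝔪` of type `(a, b)`, `e : ℚ̄_p ≃ ℂ`, the pinned `θ : Γ_K → GL₁(𝒪_{ℚ_p(S)})` (`hθ` VERBATIM) with
`[ℚ_p(S):ℚ_p] < ∞`, its dual `θ'` (`θ'·θ₀₀ = 1`), and a topological generator pair `(κ₁, κ₂, γ₁, γ₂)` (e.g. `(κc.unitTwist u₁, κ₂.unitTwist u₂, γK⁻¹, γ₂)`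
from the frame's `hγ`). THEN there are a continuous `χ₀ : Γ_K →ₜ* 𝒪ˣ`, `M > 0` and an ideal `𝔣 ≠ 0`, `𝔣 ⊆ 𝔪`, with:
`χ₀^M = 1` (**hθfin**); `θ' τ = χ₀ τ` for `τ ∈ pairKer κ₁ κ₂` (**hker**) and for every `g` with `κ₁ g = κ₂ g = 1` (so `χ₀ = θ'` on the inertia groups
outside `p`, for **hN**); `‖χ₀ g − θ' g‖ < 1` (the congruence clause of bk1); and `χ₀ σ = 1` for `σ ∈ absGaloisFixingSubgroup (rayClassField K 𝔣)`
(**hθ𝔣** of `cor53_thm52ShapeO`). [cite: JohnsonLeungKings2011, Cor. 5.3] [cite: Washington1997, §13.1, Thm. 13.4] [cite: NeukirchANT1999, Ch. VI §6 (6.4)–(6.6)]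
[cite: deShalit1987, II.1.4–1.7 (p. 35–41)] [cite: LangCyclotomic1990, Ch. 4, Appendix to §3] -/
theorem exists_frameCharacter [IsTotallyComplex K] (hK : Module.finrank ℚ K ≤ 2) {𝔪 : Ideal (𝓞 K)} (h𝔪 : 𝔪 ≠ ⊥)
    {a b : InfinitePlace K → ℤ} {ψ : HeightOneSpectrum (𝓞 K) → ℂ} (hψ : IsGrossencharakter 𝔪 a b ψ)
    (e : PadicAlgCl p ≃+* ℂ) (S : Set (PadicAlgCl p)) [FiniteDimensional ℚ_[p] (padicCoeffField S)]
    (θ : FramedGaloisRep K (padicCoeffIntegers S) 1)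
    (hθ : ∀ w : HeightOneSpectrum (𝓞 K), ((p : ℕ) : 𝓞 K) ∉ w.asIdeal → ¬ 𝔪 ≤ w.asIdeal →
      θ.IsUnramifiedAt w ∧ ∃ P : Polynomial (padicCoeffIntegers S),
        P.map (padicCoeffIntegers S).subtype = X - C (e.symm (ψ w)) ∧ θ.HasFrobCharpolyAt w P)
    (θ' : absoluteGaloisGroup K →ₜ* (padicCoeffIntegers S)ˣ)
    (hθ' : ∀ g : absoluteGaloisGroup K, ((θ' g : (padicCoeffIntegers S)ˣ) : padicCoeffIntegers S) *
      ((θ g : GL (Fin 1) (padicCoeffIntegers S)) : Matrix (Fin 1) (Fin 1) (padicCoeffIntegers S)) 0 0 = 1)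
    (κ₁ κ₂ : ZpExtension K p) {γ₁ γ₂ : absoluteGaloisGroup K} (hγ : ZpExtension.IsTopGeneratorPair κ₁ κ₂ γ₁ γ₂) :
    ∃ (χ₀ : absoluteGaloisGroup K →ₜ* (padicCoeffIntegers S)ˣ) (M : ℕ) (𝔣 : Ideal (𝓞 K)), 0 < M ∧ 𝔣 ≠ ⊥ ∧ 𝔣 ≤ 𝔪 ∧
      (∀ g, χ₀ g ^ M = 1) ∧
      (∀ τ ∈ ZpExtension.pairKer κ₁ κ₂, θ' τ = χ₀ τ) ∧
      (∀ g, κ₁ g = 1 → κ₂ g = 1 → θ' g = χ₀ g) ∧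
      (∀ g, ‖((χ₀ g : padicCoeffIntegers S) : PadicAlgCl p) - ((θ' g : padicCoeffIntegers S) : PadicAlgCl p)‖ < 1) ∧
      (∀ σ ∈ absGaloisFixingSubgroup (rayClassField K 𝔣), χ₀ σ = 1) := by
  obtain ⟨χ₀, η, M, hM0, hmul, hMord, hclose, hηker, hker, -, hεδ, ⟨r, hr, hcond⟩⟩ :=
    SmallImageRttD2FrameFinite.exists_torsionCharacter S hK κ₁ κ₂ hγ θ'
  -- `η` small on `Gal(K̄/K(𝔣₀))`, `θ'` close to `1` on `Gal(K̄/K(𝔐))`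
  obtain ⟨δ, hδ, hδη⟩ := hεδ r hr
  obtain ⟨𝔣₀, h𝔣₀, hκ⟩ := exists_ideal_forall_norm_kappa_lt κ₁ κ₂ hδ
  obtain ⟨𝔐, h𝔐, h𝔐𝔪, hθ'r⟩ := exists_ideal_forall_norm_dual_sub_one_lt h𝔪 hψ e S θ hθ θ' hθ' hr
  refine ⟨χ₀, M, 𝔐 * 𝔣₀, hM0, mul_ne_zero h𝔐 h𝔣₀, Ideal.mul_le_right.trans h𝔐𝔪, hMord, hker, fun g h1 h2 => ?_, hclose, fun σ hσ => ?_⟩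
  · rw [← hmul g, hηker g h1 h2, mul_one]
  · have hσ𝔐 : σ ∈ absGaloisFixingSubgroup (rayClassField K 𝔐) :=
      absGaloisFixingSubgroup_rayClassField_mono (mul_ne_zero h𝔐 h𝔣₀) Ideal.mul_le_right hσ
    have hσ𝔣₀ : σ ∈ absGaloisFixingSubgroup (rayClassField K 𝔣₀) :=
      absGaloisFixingSubgroup_rayClassField_mono (mul_ne_zero h𝔐 h𝔣₀) Ideal.mul_le_left hσ
    exact hcond σ (hθ'r σ hσ𝔐) (hδη σ (hκ σ hσ𝔣₀).1 (hκ σ hσ𝔣₀).2)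

/-! ## §4 (appended) The support of the conductor: `supp 𝔣 ⊆ supp 𝔪 ∪ {p}` (the `ℤ_p`-layers are unramified outside `p`) -/

/-- One layer, WITH SUPPORT: the conductor `𝔣ₙ` of `K_n` is supported on the primes above `p` (`K_n/K` is unramified at `w ∤ p`,
`isUnramifiedIn_layer_of_not_mem`; `𝔣 ≤ 𝔭_w ⟺ w` ramifies, `conductor_le_iff_not_isUnramifiedIn`), and `pⁿ ∣ κ(σ)` on `Gal(K̄/K(𝔣ₙ))`.
[cite: NeukirchANT1999, Ch. VI §6 Cor. (6.6)] [cite: Washington1997, §13.1 Prop. 13.2] -/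
theorem exists_ideal_forall_pow_dvd_supp [IsTotallyComplex K] (κ : ZpExtension K p) (n : ℕ) :
    ∃ 𝔣 : Ideal (𝓞 K), 𝔣 ≠ ⊥ ∧ (∀ w : HeightOneSpectrum (𝓞 K), ((p : ℕ) : 𝓞 K) ∉ w.asIdeal → ¬ 𝔣 ≤ w.asIdeal) ∧
      ∀ σ ∈ absGaloisFixingSubgroup (rayClassField K 𝔣), (p : ℤ_[p]) ^ n ∣ (κ σ).toAdd := by
  haveI : FiniteDimensional K (κ.layer n) := κ.finiteDimensional_layer_holds n
  haveI : IsAbelianGalois K (κ.layer n) := κ.isAbelianGalois_layer n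
  haveI : NumberField (κ.layer n) := NumberField.of_module_finite K _
  refine ⟨conductor (κ.layer n), conductor_ne_bot _, fun w hpw hle => ?_, fun σ hσ => ?_⟩
  · exact (conductor_le_iff_not_isUnramifiedIn (κ.layer n) w).mp hle (κ.isUnramifiedIn_layer_of_not_mem n hpw)
  · rw [← ZpExtension.mem_layerSubgroup, κ.mem_layerSubgroup_iff_forall_smul n σ]
    rw [mem_absGaloisFixingSubgroup_iff] at hσ
    exact fun x hx => hσ x (le_rayClassField_conductor (κ.layer n) hx)

/-- ★ Two `ℤ_p`-extensions are uniformly small on `Gal(K̄/K(𝔣₀))` for an `𝔣₀ ≠ 0` SUPPORTED ABOVE `p`.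
[cite: NeukirchANT1999, Ch. VI §6 Cor. (6.6)] [cite: Washington1997, §13.1 Prop. 13.2] -/
theorem exists_ideal_forall_norm_kappa_lt_supp [IsTotallyComplex K] (κ₁ κ₂ : ZpExtension K p) {δ : ℝ} (hδ : 0 < δ) :
    ∃ 𝔣₀ : Ideal (𝓞 K), 𝔣₀ ≠ ⊥ ∧ (∀ w : HeightOneSpectrum (𝓞 K), ((p : ℕ) : 𝓞 K) ∉ w.asIdeal → ¬ 𝔣₀ ≤ w.asIdeal) ∧
      ∀ σ ∈ absGaloisFixingSubgroup (rayClassField K 𝔣₀), ‖(κ₁ σ).toAdd‖ < δ ∧ ‖(κ₂ σ).toAdd‖ < δ := by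
  have hp1 : ‖(p : ℤ_[p])‖ < 1 := PadicInt.norm_lt_one_iff_dvd _ |>.mpr (dvd_refl _)
  obtain ⟨n, hn⟩ := exists_pow_lt_of_lt_one hδ hp1
  obtain ⟨𝔣₁, h𝔣₁, hs₁, h₁⟩ := exists_ideal_forall_pow_dvd_supp κ₁ n
  obtain ⟨𝔣₂, h𝔣₂, hs₂, h₂⟩ := exists_ideal_forall_pow_dvd_supp κ₂ n
  refine ⟨𝔣₁ * 𝔣₂, mul_ne_zero h𝔣₁ h𝔣₂, fun w hpw hle => ?_, fun σ hσ => ?_⟩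
  · rcases (w.isPrime.mul_le).mp hle with h | h
    · exact hs₁ w hpw h
    · exact hs₂ w hpw h
  have hσ₁ : σ ∈ absGaloisFixingSubgroup (rayClassField K 𝔣₁) :=
    absGaloisFixingSubgroup_rayClassField_mono (mul_ne_zero h𝔣₁ h𝔣₂) Ideal.mul_le_right hσ
  have hσ₂ : σ ∈ absGaloisFixingSubgroup (rayClassField K 𝔣₂) :=
    absGaloisFixingSubgroup_rayClassField_mono (mul_ne_zero h𝔣₁ h𝔣₂) Ideal.mul_le_left hσ
  have bound : ∀ z : ℤ_[p], (p : ℤ_[p]) ^ n ∣ z → ‖z‖ < δ := fun z hz => by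
    obtain ⟨w, rfl⟩ := hz
    calc ‖(p : ℤ_[p]) ^ n * w‖ = ‖(p : ℤ_[p])‖ ^ n * ‖w‖ := by rw [norm_mul, norm_pow]
      _ ≤ ‖(p : ℤ_[p])‖ ^ n * 1 := mul_le_mul_of_nonneg_left (PadicInt.norm_le_one w) (pow_nonneg (norm_nonneg _) _)
      _ < δ := by rw [mul_one]; exact hn
  exact ⟨bound _ (h₁ σ hσ₁), bound _ (h₂ σ hσ₂)⟩

/-- ★★★★★ **THE FRAME CHARACTER WITH SUPPORT CONTROL**: as `exists_frameCharacter`, and moreover every prime dividing the conductor `𝔣` of `χ₀`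
divides `𝔪` or lies above `p` — `supp 𝔣 ⊆ supp 𝔪 ∪ {p}`, i.e. `suppPF p 𝔣 = suppPF p 𝔪` up to the primes above `p` (-w3 g23's design point for
`RSeq`; here `𝔣 = 𝔪·p^{n+1}·𝔣₀` with `𝔣₀` a product of conductors of `ℤ_p`-layers, supported above `p`).
[cite: JohnsonLeungKings2011, Cor. 5.3] [cite: NeukirchANT1999, Ch. VI §6 (6.4)–(6.6)] [cite: Washington1997, §13.1, Prop. 13.2, Thm. 13.4] -/
theorem exists_frameCharacter_supp [IsTotallyComplex K] (hK : Module.finrank ℚ K ≤ 2) {𝔪 : Ideal (𝓞 K)} (h𝔪 : 𝔪 ≠ ⊥)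
    {a b : InfinitePlace K → ℤ} {ψ : HeightOneSpectrum (𝓞 K) → ℂ} (hψ : IsGrossencharakter 𝔪 a b ψ)
    (e : PadicAlgCl p ≃+* ℂ) (S : Set (PadicAlgCl p)) [FiniteDimensional ℚ_[p] (padicCoeffField S)]
    (θ : FramedGaloisRep K (padicCoeffIntegers S) 1)
    (hθ : ∀ w : HeightOneSpectrum (𝓞 K), ((p : ℕ) : 𝓞 K) ∉ w.asIdeal → ¬ 𝔪 ≤ w.asIdeal →
      θ.IsUnramifiedAt w ∧ ∃ P : Polynomial (padicCoeffIntegers S),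
        P.map (padicCoeffIntegers S).subtype = X - C (e.symm (ψ w)) ∧ θ.HasFrobCharpolyAt w P)
    (θ' : absoluteGaloisGroup K →ₜ* (padicCoeffIntegers S)ˣ)
    (hθ' : ∀ g : absoluteGaloisGroup K, ((θ' g : (padicCoeffIntegers S)ˣ) : padicCoeffIntegers S) *
      ((θ g : GL (Fin 1) (padicCoeffIntegers S)) : Matrix (Fin 1) (Fin 1) (padicCoeffIntegers S)) 0 0 = 1)
    (κ₁ κ₂ : ZpExtension K p) {γ₁ γ₂ : absoluteGaloisGroup K} (hγ : ZpExtension.IsTopGeneratorPair κ₁ κ₂ γ₁ γ₂) :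
    ∃ (χ₀ : absoluteGaloisGroup K →ₜ* (padicCoeffIntegers S)ˣ) (M : ℕ) (𝔣 : Ideal (𝓞 K)), 0 < M ∧ 𝔣 ≠ ⊥ ∧ 𝔣 ≤ 𝔪 ∧
      (∀ w : HeightOneSpectrum (𝓞 K), 𝔣 ≤ w.asIdeal → 𝔪 ≤ w.asIdeal ∨ ((p : ℕ) : 𝓞 K) ∈ w.asIdeal) ∧
      (∀ g, χ₀ g ^ M = 1) ∧
      (∀ τ ∈ ZpExtension.pairKer κ₁ κ₂, θ' τ = χ₀ τ) ∧
      (∀ g, κ₁ g = 1 → κ₂ g = 1 → θ' g = χ₀ g) ∧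
      (∀ g, ‖((χ₀ g : padicCoeffIntegers S) : PadicAlgCl p) - ((θ' g : padicCoeffIntegers S) : PadicAlgCl p)‖ < 1) ∧
      (∀ σ ∈ absGaloisFixingSubgroup (rayClassField K 𝔣), χ₀ σ = 1) := by
  obtain ⟨χ₀, η, M, hM0, hmul, hMord, hclose, hηker, hker, -, hεδ, ⟨r, hr, hcond⟩⟩ :=
    SmallImageRttD2FrameFinite.exists_torsionCharacter S hK κ₁ κ₂ hγ θ'
  obtain ⟨δ, hδ, hδη⟩ := hεδ r hr
  obtain ⟨𝔣₀, h𝔣₀, hs₀, hκ⟩ := exists_ideal_forall_norm_kappa_lt_supp κ₁ κ₂ hδ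
  -- the `θ'`-modulus `𝔐 = 𝔪·p^{n+1}` with `‖p‖^{n+1} < r`
  have hp1 : ‖(p : padicCoeffIntegers S)‖ < 1 := by
    rw [SmallImageRttD2FrameReciprocity.norm_natCast_coeffIntegers]; exact Literature.NumberTheory.Automorphic.PadicAlgCl.norm_natCast_p_lt_one p
  obtain ⟨n, hn⟩ := exists_pow_lt_of_lt_one hr hp1
  obtain ⟨h1, h2, h3⟩ := SmallImageRttD2FrameReciprocity.mul_span_natCast_pow_props (K := K) (p := p) h𝔪 n
  set 𝔐 : Ideal (𝓞 K) := 𝔪 * Ideal.span {((p : ℕ) : 𝓞 K)} ^ (n + 1) with h𝔐_def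
  have hθ'r : ∀ σ ∈ absGaloisFixingSubgroup (rayClassField K 𝔐),
      ‖(((θ' σ : (padicCoeffIntegers S)ˣ) : padicCoeffIntegers S) : PadicAlgCl p) - 1‖ < r := fun σ hσ => by
    have h := SmallImageRttD2FrameReciprocity.norm_dual_sub_one_le_of_mem_fixingSubgroup h𝔪 hψ e S θ hθ θ' hθ' h1 h2 h3 hσ
    rw [SmallImageRttD2FrameReciprocity.norm_coeffIntegers_eq, AddSubgroupClass.coe_sub, OneMemClass.coe_one] at h
    exact h.trans_lt ((pow_le_pow_of_le_one (norm_nonneg _) hp1.le (Nat.le_succ n)).trans_lt hn)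
  refine ⟨χ₀, M, 𝔐 * 𝔣₀, hM0, mul_ne_zero h1 h𝔣₀, Ideal.mul_le_right.trans h2, fun w hw => ?_, hMord, hker, fun g hg1 hg2 => ?_, hclose,
    fun σ hσ => ?_⟩
  · -- support: `w ∣ 𝔪 p^{n+1} 𝔣₀ ⟹ w ∣ 𝔪 ∨ p ∈ w`
    by_cases hpw : ((p : ℕ) : 𝓞 K) ∈ w.asIdeal
    · exact Or.inr hpw
    · left
      rcases (w.isPrime.mul_le).mp hw with h𝔐w | h𝔣₀w
      · rcases (w.isPrime.mul_le).mp h𝔐w with h𝔪w | hpw'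
        · exact h𝔪w
        · exact absurd (Ideal.span_singleton_le_iff_mem _ |>.mp ((Ideal.IsPrime.pow_le_iff (Nat.succ_ne_zero n)).mp hpw')) hpw
      · exact absurd h𝔣₀w (hs₀ w hpw)
  · rw [← hmul g, hηker g hg1 hg2, mul_one]
  · have hσ𝔐 : σ ∈ absGaloisFixingSubgroup (rayClassField K 𝔐) :=
      absGaloisFixingSubgroup_rayClassField_mono (mul_ne_zero h1 h𝔣₀) Ideal.mul_le_right hσ
    have hσ𝔣₀ : σ ∈ absGaloisFixingSubgroup (rayClassField K 𝔣₀) :=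
      absGaloisFixingSubgroup_rayClassField_mono (mul_ne_zero h1 h𝔣₀) Ideal.mul_le_left hσ
    exact hcond σ (hθ'r σ hσ𝔐) (hδη σ (hκ σ hσ𝔣₀).1 (hκ σ hσ𝔣₀).2)

end Summit.BirchSwinnertonDyer.BirchSwinnertonDyer.Theorems.SmallImageRttD2FrameConductor

end
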